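import Literature.NumberTheory.Sieve.LargestPrimeFactorCubicSawCount
import HarnessLib

/-!
# Heath-Brown 2001 (PLMS), Lemma 10 over rectangles: `|S(q,k; A,U₁,B,U₂) − U₁U₂/q| ≤ 2M(q,k)`

Topic `Literature/NumberTheory/Sieve`; a PROVED layer (one definition with body, no named facts) under
the named fact `Irving2015_largestPrimeFactor_cubic` (`LargestPrimeFactorCubic.lean`), the rectangle
version of `…SawCount` (`Scount` counts over a square `(A, A+U]²`).  Source: D. R. Heath-Brown, *The
largest prime factor of `X³ + 2`*, Proc. London Math. Soc. (3) 82 (2001) 554–596, §7: Lemma 10 (p. 23)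
is applied in (7.3) (p. 25) to the boxes `(A/d, (A+M)/d] × (B/d, (B+M)/d]`, whose integer points form a
RECTANGLE `(A', A'+U₁] × (B', B'+U₂]` with `U₁, U₂ ∈ {⌊M/d⌋, ⌊M/d⌋ + 1}`; so the per-modulus bound is
needed for rectangles:

* `Scount₂ q k A U₁ B U₂ = #{A < a ≤ A+U₁, B < b ≤ B+U₂ : q ∣ a − bk}` (`Scount₂_self`: the square case
  is `Scount`), `Scount₂_eq_sum`, `Scount₂_sub_eq` (`S − U₁U₂/q = ∑_b ψ((A−bk)/q) − ψ((A+U₁−bk)/q)`),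
  **`abs_Scount₂_sub_le`** (`|S − U₁U₂/q| ≤ 2 · sawMajorant V U₂ k q`).

## References

* D. R. Heath-Brown, *The largest prime factor of `X³ + 2`*, Proc. London Math. Soc. (3) 82 (2001)
  554–596, §7, Lemma 10 p. 23, (7.2) p. 24, (7.3) p. 25. [`HeathBrown2001LargestPrimeFactorCubic`]

## Mathlib / tree search

Tree: `Scount`, `card_Ioc_filter_modEq_eq_saw`, `sawMajorant`, `abs_sum_saw_ap_le` (`…SawCount`),
`LFunctions.AFE.saw`.  Mathlib: `Nat.modEq_iff_dvd`, `Finset.sum_product_right`, `Nat.card_Ioc`.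
-/

noncomputable section

open Finset Real

namespace Literature.NumberTheory.Sieve.HeathBrown2001

open Literature.NumberTheory.LFunctions.AFE (saw)

/-! ### The count over a rectangle -/

/-- `S(q, k; A, U₁, B, U₂) = #{A < a ≤ A+U₁, B < b ≤ B+U₂ : q ∣ a − bk}`.
[cite: HeathBrown2001LargestPrimeFactorCubic, Lemma 10 p. 23 and (7.3) p. 25] -/
def Scount₂ (q k A U₁ B U₂ : ℕ) : ℕ :=
  #((Ioc A (A + U₁) ×ˢ Ioc B (B + U₂)).filter fun ab : ℕ × ℕ => (q : ℤ) ∣ (ab.1 : ℤ) - ab.2 * k)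

/-- The square case is `Scount`. [folklore] -/
theorem Scount₂_self (q k A B U : ℕ) : Scount₂ q k A U B U = Scount q k A B U := rfl

/-- Fibring over `b`. [folklore] -/
theorem Scount₂_eq_sum (q k A U₁ B U₂ : ℕ) :
    (Scount₂ q k A U₁ B U₂ : ℝ) =
      ∑ b ∈ Ioc B (B + U₂), (#((Ioc A (A + U₁)).filter fun a : ℕ => a ≡ b * k [MOD q]) : ℝ) := by
  classical
  have hiff : ∀ a b : ℕ, ((q : ℤ) ∣ (a : ℤ) - b * k) ↔ a ≡ b * k [MOD q] := by
    intro a b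
    rw [Nat.modEq_iff_dvd, ← dvd_neg, neg_sub]
    push_cast
    exact Iff.rfl
  unfold Scount₂
  rw [card_eq_sum_ones, sum_filter, sum_product_right]
  push_cast
  refine sum_congr rfl fun b _ => ?_
  rw [card_eq_sum_ones, sum_filter]
  push_cast
  refine sum_congr rfl fun a _ => ?_
  simp only [hiff]

/-- **`S − U₁U₂/q = ∑_b ψ((A − bk)/q) − ψ((A+U₁−bk)/q)`** (`q ≥ 1`).
[cite: HeathBrown2001LargestPrimeFactorCubic, §7 (7.2)] -/
theorem Scount₂_sub_eq {q : ℕ} (hq : 0 < q) (k A U₁ B U₂ : ℕ) :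
    (Scount₂ q k A U₁ B U₂ : ℝ) - (U₁ : ℝ) * U₂ / q =
      ∑ b ∈ Ioc B (B + U₂), (saw (((A : ℝ) - b * k) / q) - saw (((A : ℝ) + U₁ - b * k) / q)) := by
  rw [Scount₂_eq_sum]
  have h : ∀ b ∈ Ioc B (B + U₂), (#((Ioc A (A + U₁)).filter fun a : ℕ => a ≡ b * k [MOD q]) : ℝ) =
      (U₁ : ℝ) / q + (saw (((A : ℝ) - b * k) / q) - saw (((A : ℝ) + U₁ - b * k) / q)) := by
    intro b _
    rw [card_Ioc_filter_modEq_eq_saw hq A U₁ (b * k)]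
    push_cast
    ring
  rw [sum_congr rfl h, sum_add_distrib, sum_const, Nat.card_Ioc, nsmul_eq_mul]
  have : ((B + U₂ - B : ℕ) : ℝ) = U₂ := by rw [Nat.add_sub_cancel_left]
  rw [this]
  ring

/-- **`|S − U₁U₂/q| ≤ 2 M(q,k)`** (`q, V ≥ 1`; `M` = `sawMajorant V U₂`).
[cite: HeathBrown2001LargestPrimeFactorCubic, §7 (7.2)] -/
theorem abs_Scount₂_sub_le {q V : ℕ} (hq : 0 < q) (hV : 1 ≤ V) (k A U₁ B U₂ : ℕ) :
    |(Scount₂ q k A U₁ B U₂ : ℝ) - (U₁ : ℝ) * U₂ / q| ≤ 2 * sawMajorant V U₂ k q := by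
  rw [Scount₂_sub_eq hq, sum_sub_distrib]
  have h1 := abs_sum_saw_ap_le hV B U₂ (A : ℝ) k q
  have h2 := abs_sum_saw_ap_le hV B U₂ ((A : ℝ) + U₁) k q
  calc |∑ b ∈ Ioc B (B + U₂), saw (((A : ℝ) - b * k) / q) - ∑ b ∈ Ioc B (B + U₂), saw (((A : ℝ) + U₁ - b * k) / q)|
      ≤ |∑ b ∈ Ioc B (B + U₂), saw (((A : ℝ) - b * k) / q)| + |∑ b ∈ Ioc B (B + U₂), saw (((A : ℝ) + U₁ - b * k) / q)| :=
        abs_sub _ _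
    _ ≤ sawMajorant V U₂ k q + sawMajorant V U₂ k q := add_le_add h1 h2
    _ = 2 * sawMajorant V U₂ k q := by ring

end Literature.NumberTheory.Sieve.HeathBrown2001
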